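import Summits.RiemannHypothesis.RiemannHypothesis.Theorems.GroundBartaEvenWinsBeyondArchDeflationRN25EWinF
import HarnessLib

/-!
# RiemannHypothesis / GroundBarta — rung 4 (`EvenWinsBeyondArch`): R-layer certificate of cell `RN25E` — projection constants

Generated by `tools/rgen/gen.py consts` (prover B): `rn25eMc` (midpoint of the certified bracket of the window's Markov constant) and
`rn25eWd = diag(ρ̃)` (prover A's Ritz values), the coefficients `W_il = W̃_il + δ_il (M̃ − M_c)` of the sigma criterion.
-/

set_option linter.dupNamespace false

noncomputable section

open MeasureTheory Set Filter intervalIntegral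
open scoped Topology BigOperators

namespace Summit.RiemannHypothesis.RiemannHypothesis.Theorems.EvenWinsBeyondArch

open Literature.NumberTheory.LFunctions
open Literature.Analysis.ValidatedNumerics Literature.Analysis.ValidatedNumerics.PolyMP
  Literature.Analysis.ValidatedNumerics.NumericsMP Literature.Analysis.ValidatedNumerics.ExpPoly
/-- `M̃`: midpoint of the certified bracket of `M_{18/25}` -/
def rn25eMc : ℚ := ((8314156944449289837 : ℚ)/1000000000000000000)
/-- `W̃ = diag(ρ̃)` (A's Ritz values) -/
def rn25eWd : Fin 6 → Fin 6 → ℚ := fun a l ↦ if a = l then (![((9632699456401868971143948626949 : ℚ)/1000000000000000000000000000000000000000000000000), ((5125357943652038072756573966543 : ℚ)/1000000000000000000000000000000000000000000), ((2092212730391699638701848537757 : ℚ)/5000000000000000000000000000000000000), ((1205196225654432498198321525133 : ℚ)/500000000000000000000000000000000), ((3045095962544342869634676490137 : ℚ)/5000000000000000000000000000000), ((4268140454053501533022875040877 : ℚ)/5000000000000000000000000000000)] : Fin 6 → ℚ) a else 0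

end Summit.RiemannHypothesis.RiemannHypothesis.Theorems.EvenWinsBeyondArch

end
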